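import Literature.Probability.RandomPlanarGeometry.SAWQuantitativeHW
import HarnessLib

/-!
# Hutchcroft 2018, Remark 1.6: the bridge generating function below `z_c` under a power-law
# sub-ballisticity hypothesis — `B((1-ε)z_c) = O(ε^{(1-ν)/ν})`

Topic `Literature/Probability/RandomPlanarGeometry` (continues `SAWQuantitativeHW.lean`: the repaired
power-law hypothesis `BridgeHeightDecay d ν A C`, its windows `BridgeHeightDecay.window`, the Fekete rate
`brGF_subcrit_le_pow`, and `bridgeGFpos_le_of_brGF_le` of `SAWBridgeSpanGF.lean`). Source: T. Hutchcroft,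
Electron. Commun. Probab. 23 (2018) no. 5 (arXiv:1708.09460), Remark 1.6: "The central step in the proof
of Theorem 1.4 is to show that the generating function `B(z) = Σ_{n≥0} z^n b_n` satisfies
`B((1-ε)z_c) ≤ [1-(1-ε)^{ψ(ε)}]^{-1}`. In particular, we obtain that if `φ(ε) = Cε^ν` satisfies (1.1) for
some `C > 0` and `ν > 1`, then `B((1-ε)z_c) = O(ε^{(1-ν)/ν})` as `ε → 0` (1.2). This can be thought
of as an inequality between the 'sub-ballisticity exponent' and the bridge counting exponent."
(Hypothesis (1.1) read with a prefactor — see the READING NOTE in `SAWQuantitativeHW.lean`.)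

## Contents (namespace `Literature.Probability.RandomPlanarGeometry.SAW.Zd`; all PROVED)

* **`bridgeGFpos_subcrit_le_of_heightDecay`** — eq. (1.2) in finite form with an explicit constant,
  every `d ≥ 1`: under `BridgeHeightDecay d ν A C` (`ν > 1`, `C > 0`), for `0 < ε ≤ 1/2` and every
  truncation `M`, `B⁺_M((1-ε)z_c) = Σ_{1≤m≤M} b_m ((1-ε)z_c)^m ≤ (4·2^{ν-1}/min(1/2,C)) · ε^{-(ν-1)/ν}`
  (window at `ℓ = ⌈(min(1/2,C)/ε)^{1/ν}⌉`, `ε' = min(1/2,C) ℓ^{-ν} ≤ ε`, monotonicity in `z`,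
  `B⁺ ≤ ρ/(1-ρ) ≤ (2/min(1/2,C)) ℓ^{ν-1}`).
-/

noncomputable section

open Finset Filter Topology Literature.Probability.LatticeModels Literature.Probability.Percolation
open scoped BigOperators

namespace Literature.Probability.RandomPlanarGeometry.SAW.Zd

variable {d : ℕ} [NeZero d]

/-- `u/2 ≤ 1 - e^{-u}` for `0 ≤ u ≤ 1`. [folklore] -/
private theorem half_le_one_sub_exp_neg' {u : ℝ} (hu0 : 0 ≤ u) (hu1 : u ≤ 1) :
    u / 2 ≤ 1 - Real.exp (-u) := by
  have h1 : Real.exp (-u) * (1 + u) ≤ 1 := by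
    calc Real.exp (-u) * (1 + u) ≤ Real.exp (-u) * Real.exp u := by
          refine mul_le_mul_of_nonneg_left ?_ (Real.exp_nonneg _)
          linarith [Real.add_one_le_exp u]
      _ = 1 := by rw [← Real.exp_add, neg_add_cancel, Real.exp_zero]
  nlinarith [Real.exp_pos (-u)]


/-- `bridgeGFpos` is monotone in `z ≥ 0`. [folklore] -/
private theorem bridgeGFpos_mono (M : ℕ) {z₁ z₂ : ℝ} (hz₁ : 0 ≤ z₁) (h : z₁ ≤ z₂) :
    bridgeGFpos d M z₁ ≤ bridgeGFpos d M z₂ := by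
  refine Finset.sum_le_sum fun n _ => ?_
  split_ifs
  · exact le_rfl
  · exact mul_le_mul_of_nonneg_left (pow_le_pow_left₀ hz₁ h n) (Nat.cast_nonneg _)

/-- **Remark 1.6 (eq. (1.2)), finite form with an explicit constant**: under `BridgeHeightDecay d ν A C`
(`ν > 1`, `C > 0`), for every `0 < ε ≤ 1/2` and every truncation `M`,
`B⁺_M((1-ε)z_c) = Σ_{1≤m≤M} b_m ((1-ε)z_c)^m ≤ (4 · 2^{ν-1}/min(1/2,C)) · ε^{-(ν-1)/ν}`
("`B((1-ε)z_c) = O(ε^{(1-ν)/ν})` as `ε → 0` … an inequality between the sub-ballisticity exponent and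
the bridge counting exponent"). Proof: the window at `ℓ = ⌈(min(1/2,C)/ε)^{1/ν}⌉` has rate
`Cℓ^{1-ν}`; with `ε' = min(1/2,C) ℓ^{-ν} ≤ ε`, `B⁺((1-ε)z_c) ≤ B⁺((1-ε')z_c) ≤ ρ/(1-ρ) ≤ (2/min(1/2,C)) ℓ^{ν-1}`.
[cite: Hutchcroft2018HammersleyWelsh, Remark 1.6, eq. (1.2)] -/
theorem bridgeGFpos_subcrit_le_of_heightDecay {ν A C : ℝ} (h : BridgeHeightDecay d ν A C)
    (hν : 1 < ν) (hC : 0 < C) {ε : ℝ} (hε0 : 0 < ε) (hεh : ε ≤ 1 / 2) (M : ℕ) :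
    bridgeGFpos d M ((1 - ε) * (connectiveConstant d)⁻¹) ≤
      (4 * (2 : ℝ) ^ (ν - 1) / min (1 / 2) C) * ε ^ (-((ν - 1) / ν)) := by
  have hμ := connectiveConstant_pos d
  have hν0 : 0 < ν := by linarith
  set c₁ : ℝ := min (1 / 2) C with hc₁
  have hc₁0 : 0 < c₁ := lt_min (by norm_num) hC
  have hc₁h : c₁ ≤ 1 / 2 := min_le_left _ _
  have hc₁C : c₁ ≤ C := min_le_right _ _
  -- `x = (c₁/ε)^{1/ν}`, `ℓ = max ⌈x⌉ 1`
  set x : ℝ := (c₁ / ε) ^ (1 / ν) with hx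
  have hx0 : 0 < x := Real.rpow_pos_of_pos (div_pos hc₁0 hε0) _
  have hxν : x ^ ν = c₁ / ε := by
    rw [hx, ← Real.rpow_mul (div_pos hc₁0 hε0).le, one_div_mul_cancel hν0.ne', Real.rpow_one]
  set ℓ : ℕ := max ⌈x⌉₊ 1 with hℓ
  have hℓ1 : 1 ≤ ℓ := le_max_right _ _
  have hℓ0 : (0 : ℝ) < ℓ := by exact_mod_cast hℓ1
  have hℓ1' : (1 : ℝ) ≤ ℓ := by exact_mod_cast hℓ1
  have hxℓ : x ≤ (ℓ : ℝ) := (Nat.le_ceil x).trans (by exact_mod_cast le_max_left _ _)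
  have hℓx : (ℓ : ℝ) ≤ 2 * max x 1 := by
    rcases le_total (⌈x⌉₊) 1 with hc | hc
    · rw [hℓ, max_eq_right hc]; push_cast; linarith [le_max_right x 1]
    · rw [hℓ, max_eq_left hc]
      have := Nat.ceil_lt_add_one hx0.le
      linarith [le_max_left x 1, le_max_right x 1]
  -- `ε' = c₁ ℓ^{-ν} ≤ ε`, `ε' ∈ (0, 1/2]`
  set ε' : ℝ := c₁ * (ℓ : ℝ) ^ (-ν) with hε'
  have hℓν0 : 0 < (ℓ : ℝ) ^ (-ν) := Real.rpow_pos_of_pos hℓ0 _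
  have hε'0 : 0 < ε' := mul_pos hc₁0 hℓν0
  have hε'h : ε' ≤ 1 / 2 := by
    calc ε' ≤ c₁ * 1 := mul_le_mul_of_nonneg_left
          (Real.rpow_le_one_of_one_le_of_nonpos hℓ1' (by linarith)) hc₁0.le
      _ ≤ 1 / 2 := by linarith
  have hε'1 : ε' < 1 := by linarith
  have hε'ε : ε' ≤ ε := by
    have h1 : c₁ / ε ≤ (ℓ : ℝ) ^ ν := by
      rw [← hxν]; exact Real.rpow_le_rpow hx0.le hxℓ hν0.le
    have h2 : 0 < (ℓ : ℝ) ^ ν := Real.rpow_pos_of_pos hℓ0 _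
    rw [hε', Real.rpow_neg hℓ0.le, ← div_eq_mul_inv, div_le_iff₀ h2]
    calc c₁ = (c₁ / ε) * ε := by field_simp
      _ ≤ (ℓ : ℝ) ^ ν * ε := mul_le_mul_of_nonneg_right h1 hε0.le
      _ = ε * (ℓ : ℝ) ^ ν := mul_comm _ _
  -- the window bound at `ε'`
  set c : ℝ := C * (ℓ : ℝ) ^ (1 - ν) with hc
  have hwin := h.window hν.le hC.le ℓ
  set ρ : ℝ := max ((1 - ε') ^ ℓ) ((1 - ε') * Real.exp (-c)) with hρ
  have hρ0 : 0 ≤ ρ := le_max_of_le_left (pow_nonneg (by linarith) ℓ)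
  -- `u = c₁ ℓ^{1-ν} ∈ (0,1]`, `ρ ≤ e^{-u}`, `1 - ρ ≥ u/2`
  have hℓ1ν0 : 0 < (ℓ : ℝ) ^ (1 - ν) := Real.rpow_pos_of_pos hℓ0 _
  have hℓ1ν1 : (ℓ : ℝ) ^ (1 - ν) ≤ 1 := Real.rpow_le_one_of_one_le_of_nonpos hℓ1' (by linarith)
  set u : ℝ := c₁ * (ℓ : ℝ) ^ (1 - ν) with hu
  have hu0 : 0 < u := mul_pos hc₁0 hℓ1ν0
  have hu1 : u ≤ 1 := by
    calc u ≤ c₁ * 1 := mul_le_mul_of_nonneg_left hℓ1ν1 hc₁0.le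
      _ ≤ 1 := by linarith
  have hρu : ρ ≤ Real.exp (-u) := by
    refine max_le ?_ ?_
    · calc (1 - ε') ^ ℓ ≤ Real.exp (-ε') ^ ℓ :=
            pow_le_pow_left₀ (by linarith) (Real.one_sub_le_exp_neg ε') ℓ
        _ = Real.exp (-u) := by
            rw [← Real.exp_nat_mul]
            congr 1
            rw [hu, hε', show (1 : ℝ) - ν = -ν + 1 by ring, Real.rpow_add_one hℓ0.ne']
            ring
    · calc (1 - ε') * Real.exp (-c) ≤ 1 * Real.exp (-c) :=
            mul_le_mul_of_nonneg_right (by linarith) (Real.exp_nonneg _)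
        _ ≤ Real.exp (-u) := by
            rw [one_mul, Real.exp_le_exp, hu, hc, neg_le_neg_iff]
            exact mul_le_mul_of_nonneg_right hc₁C hℓ1ν0.le
  have hρ1' : ρ ≤ 1 := hρu.trans (by rw [Real.exp_le_one_iff]; linarith)
  have h1ρ : u / 2 ≤ 1 - ρ := (half_le_one_sub_exp_neg' hu0.le hu1).trans (by linarith)
  have hρ1 : ρ < 1 := by linarith
  -- `B⁺((1-ε)z_c) ≤ B⁺((1-ε')z_c) ≤ ρ/(1-ρ) ≤ 2/u = (2/c₁) ℓ^{ν-1}`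
  have hB : bridgeGFpos d M ((1 - ε') * (connectiveConstant d)⁻¹) ≤ ρ / (1 - ρ) :=
    bridgeGFpos_le_of_brGF_le M (by positivity) hρ0 hρ1
      fun A' hA' => brGF_subcrit_le_pow hwin hℓ1 hε'0 hε'1 M hA'
  have hmono : bridgeGFpos d M ((1 - ε) * (connectiveConstant d)⁻¹) ≤
      bridgeGFpos d M ((1 - ε') * (connectiveConstant d)⁻¹) :=
    bridgeGFpos_mono M (mul_nonneg (by linarith) (inv_nonneg.2 hμ.le))
      (mul_le_mul_of_nonneg_right (by linarith) (inv_nonneg.2 hμ.le))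
  have hfrac : ρ / (1 - ρ) ≤ (2 / c₁) * (ℓ : ℝ) ^ (ν - 1) := by
    have e1 : ρ / (1 - ρ) ≤ 1 / (u / 2) := div_le_div₀ zero_le_one hρ1' (by linarith) h1ρ
    have e2 : 1 / (u / 2) = (2 / c₁) * (ℓ : ℝ) ^ (ν - 1) := by
      rw [hu, show (1 : ℝ) - ν = -(ν - 1) by ring, Real.rpow_neg hℓ0.le]
      field_simp
    rw [← e2]; exact e1
  -- `ℓ^{ν-1} ≤ (2 max(x,1))^{ν-1} ≤ 2^{ν-1} (x^{ν-1} + 1) ≤ 2^{ν-1} · 2 ε^{-(ν-1)/ν}`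
  have hβ0 : 0 ≤ ν - 1 := by linarith
  have hεβ : 1 ≤ ε ^ (-((ν - 1) / ν)) := by
    rw [Real.rpow_neg hε0.le]
    refine one_le_inv_iff₀.2 ⟨Real.rpow_pos_of_pos hε0 _, ?_⟩
    exact Real.rpow_le_one hε0.le (by linarith) (div_nonneg hβ0 hν0.le)
  have hxβ : x ^ (ν - 1) ≤ ε ^ (-((ν - 1) / ν)) := by
    have e1 : x ^ (ν - 1) = (c₁ / ε) ^ ((ν - 1) / ν) := by
      rw [hx, ← Real.rpow_mul (div_pos hc₁0 hε0).le]
      congr 1; field_simp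
    have e2 : (c₁ / ε) ^ ((ν - 1) / ν) = c₁ ^ ((ν - 1) / ν) * ε ^ (-((ν - 1) / ν)) := by
      rw [Real.div_rpow hc₁0.le hε0.le, Real.rpow_neg hε0.le, div_eq_mul_inv]
    have e3 : c₁ ^ ((ν - 1) / ν) ≤ 1 := Real.rpow_le_one hc₁0.le (by linarith) (div_nonneg hβ0 hν0.le)
    rw [e1, e2]
    calc c₁ ^ ((ν - 1) / ν) * ε ^ (-((ν - 1) / ν)) ≤ 1 * ε ^ (-((ν - 1) / ν)) :=
          mul_le_mul_of_nonneg_right e3 (by linarith)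
      _ = ε ^ (-((ν - 1) / ν)) := one_mul _
  have hmax : (max x 1) ^ (ν - 1) ≤ x ^ (ν - 1) + 1 := by
    rcases le_total x 1 with hx1 | hx1
    · rw [max_eq_right hx1, Real.one_rpow]
      linarith [Real.rpow_nonneg hx0.le (ν - 1)]
    · rw [max_eq_left hx1]
      linarith
  have hℓβ : (ℓ : ℝ) ^ (ν - 1) ≤ (2 : ℝ) ^ (ν - 1) * (2 * ε ^ (-((ν - 1) / ν))) := by
    calc (ℓ : ℝ) ^ (ν - 1) ≤ (2 * max x 1) ^ (ν - 1) := Real.rpow_le_rpow hℓ0.le hℓx hβ0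
      _ = (2 : ℝ) ^ (ν - 1) * (max x 1) ^ (ν - 1) :=
          Real.mul_rpow (by norm_num) (le_max_of_le_right zero_le_one)
      _ ≤ (2 : ℝ) ^ (ν - 1) * (x ^ (ν - 1) + 1) := by gcongr
      _ ≤ (2 : ℝ) ^ (ν - 1) * (2 * ε ^ (-((ν - 1) / ν))) := by gcongr; linarith
  calc bridgeGFpos d M ((1 - ε) * (connectiveConstant d)⁻¹)
      ≤ (2 / c₁) * (ℓ : ℝ) ^ (ν - 1) := hmono.trans (hB.trans hfrac)
    _ ≤ (2 / c₁) * ((2 : ℝ) ^ (ν - 1) * (2 * ε ^ (-((ν - 1) / ν)))) :=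
        mul_le_mul_of_nonneg_left hℓβ (by positivity)
    _ = (4 * (2 : ℝ) ^ (ν - 1) / c₁) * ε ^ (-((ν - 1) / ν)) := by ring

end Literature.Probability.RandomPlanarGeometry.SAW.Zd

end
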